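import Literature.AlgebraicGeometry.ModuliOfAbelianVarieties.SiegelFamilyNoetherLefschetzTypesNonempty
import Literature.Geometry.Kaehler.ComplexTorusEllipticCurveDegree
import HarnessLib

/-!
# Iribar López's `NL_{g,d}` in every genus: the principally polarised abelian varieties containing an elliptic
# curve of degree `d` (Iribar López 2024, §1.5; Greer–Lian; Kani 1994; Auffarth 2015, §2)

Layer `Literature/AlgebraicGeometry/ModuliOfAbelianVarieties`, namespace
`Literature.AlgebraicGeometry.ModuliOfAbelianVarieties.SiegelModuli`; lane `lit-hodgefound` (Track 2 foundations
library, Layer A4), seat `lit-hodgefound-skel-4` (gen 25), row **A4-75** of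
`run/shared/lean/pub/lit-hodgefound/SKELETON.md` (§A4-DETAIL), FILE 3 — the case `u = 1` of rows A4-74/A4-75
(`nlLocusType g ![d]` = Iribar López's `NL_{g,d}` = `NL_{g,(d)}`) in EVERY genus, read in the elliptic-curve
vocabulary of rows A4-18/A4-60/A4-61 (`SubtorusFrame Φ_Z 2`, degree `−E_Z(Φλ′₀, Φλ′₁)`): row A4-74 FILE 3
(`SiegelFamilyProductLociGenusTwo`) did `g = 2` through Kani's `N_{d²}`; here the bridge «abelian subvariety of
dimension `1` with induced polarization of type `(d)`» ⟷ «elliptic curve of degree `d`» is proved for all `g`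
directly (Riemann–Roch on the curve: `|K(E_Z|_Y)| = (deg Y)²`, p09/p10), so that FILE 2's non-emptiness and
classification specialise to «some / which p.p.a.v. of dimension `g` contain an elliptic curve of degree `d`».
THEOREMS ONLY; no definition, no named fact, nothing conditional (D-0026, net debt `0`).

## Sources, verbatim (materialised pages)

* A. Iribar López, *Noether–Lefschetz cycles on the moduli space of abelian varieties*, Forum Math. Pi (2024)
  [held `paper:arxiv-2411.09910`], §1.2 (p0003 L49–L55: `NL_{g,δ}`), §1.5 (p0004 L64–L71): «when `g = 2`,
  `NL_{g,d}` is the Humbert surface of discriminant `d²` … Greer and Lian [GL24, GLS24] consider the stacks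
  `𝒩̃_{g,d} = {f : E → (A, θ) ∣ (A, θ) ∈ 𝒜_g, E is an elliptic curve and f is an homomorphism such that
  (f^*θ) = d}`, which have several connected components that correspond to our `NL_{g,e}` for `e ∣ d`».
* R. Auffarth, *Elliptic curves on abelian varieties*, Illinois J. Math. **59** (2015)
  [held `paper:arxiv-1507.08617`], §2 (p0006): «The degree of a curve `C` on `A` is defined analogously as
  `deg C := (C · Θ)`», Thm. 2.10 («`deg α > 0`»).
* H. Lange, *Abelian Varieties over the Complex Numbers* (2023), §1.5.1 (p0051: the type), §5.3.1 Lemma 5.3.1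
  and §3.6 (Riemann–Roch: `deg φ_L = |K(L)| = Pf(E)²`).

## What is proved (`Z ∈ 𝔥_g`, `Φ_Z = prinPeriod Z`, `E_Z = prinForm Z`; an elliptic curve `Y ⊂ X_Z` is a
`SubtorusFrame Φ_Z 2`, its degree `deg Y = −E_Z(Φλ′₀, Φλ′₁)`; `d : ℕ`)

* §1 (every genus) `realSpan_eq_map_comap_prinPeriod`, `finrank_comap_realSpan_prinPeriod_eq_two`,
  `one_le_of_subtorusFrame_two` (`g ≥ 1` as soon as an elliptic curve exists), **`exists_nat_degree_eq`** (the degree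
  of an elliptic curve is a positive integer — integrality of `E_Z` and `IsRiemannForm.apply_frame_neg`),
  **`natCard_subK_eq_degree_sq_prinPeriod`** (`|K(E_Z|_Y)| = (deg Y)²`, p09's
  `torusIntegral_wedgePow_neg_wedge_cycleForm_div_factorial_sq` at `r = 1`).
* §2 THE BRIDGE (every genus): **`isSubPolarizationType_singleton_of_degree_eq`** (an elliptic curve of degree `d` is
  an abelian subvariety of type `(d)`), **`exists_subtorusFrame_of_isSubPolarizationType_singleton`** (conversely, via
  p36's `SubtorusFrame.ofSubspace`), MAIN **`mem_nlLocusType_singleton_iff_exists_ellipticCurve`**: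
  `Z ∈ NL_{g,(d)} ⟺ X_Z ⊃` an elliptic curve of degree `d` — Iribar López's `NL_{g,d}` IS the locus of p.p.a.v.
  containing an elliptic curve of degree `d`, Kani's / Greer–Lian's reading.
* §3 COROLLARIES: `exists_ellipticCurve_degree_eq` (for `g ≥ 2`, every degree `d ≥ 1` is the degree of an elliptic
  curve on some p.p.a.v. of dimension `g` — FILE 2's `nlLocusType_singleton_nonempty`),
  `mem_abelianSubvarietyLocus_one_iff_nonempty_subtorusFrame` (type (i) of dimension `1` = «contains an elliptic
  curve»), **`abelianSubvarietyLocus_one_eq_iUnion_nlLocusType_singleton`** (`= ⋃_{d ≥ 1} NL_{g,d}`: «several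
  connected components that correspond to our `NL_{g,e}`» at the level of sets), `nlLocusType_singleton_zero`
  (`NL_{g,0} = ∅`), `nlLocusType_singleton_subset_nonSimpleLocus`.  (At `g = 2` the bridge recovers row A4-74
  FILE 3's `nlLocusType_two_eq_humbertLocusPrim_sq` = Kani's `mem_humbertLocusPrim_sq_iff_exists_ellipticCurve`;
  not restated.)

## Not here

Stack structures, classes `[NL_{g,d}]`, Corollary 4 (the Eisenstein series), the components of `𝒩̃_{g,d}`.

## References

* [IribarLopez2024NoetherLefschetzCycles] §1.2 (p. 3), §1.5 (p. 4).
* [Auffarth2015EllipticCurvesAbelianVarieties] §2, Thm. 2.10.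
* [Kani1994EllipticCurvesAbelianSurfaces] (degrees of elliptic curves on abelian surfaces).
* [Lange2023AbelianVarietiesComplex] §1.5.1 (p. 51), §5.3.1, §3.6.
-/

noncomputable section

open Matrix Module Function Set
open scoped Topology

namespace Literature.AlgebraicGeometry.ModuliOfAbelianVarieties

namespace SiegelModuli

open Literature.NumberTheory.Automorphic (siegelUpperHalfSpace)
open Literature.NumberTheory.ModularForms.SiegelUpperHalfSpace
open Literature.Geometry.Kaehler Literature.Geometry.Kaehler.ComplexTorus
open Literature.Analysis.Complex Literature.LinearAlgebra.Alternating

variable {g : ℕ} (Z : siegelUpperHalfSpace g)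

/-! ## §1 Elliptic curves on `X_Z` in every genus: the lattice plane, integrality and positivity of the degree,
`|K(E_Z|_Y)| = (deg Y)²` -/

/-- The tangent plane of an elliptic curve `Y ⊂ X_Z` is `Φ_Z` of its lattice plane `W_Y = Φ_Z⁻¹(T_Y)` (any genus).
[cite: Lange2023AbelianVarietiesComplex, §1.1.6 Exercise (2)(a) (p. 26)] -/
theorem realSpan_eq_map_comap_prinPeriod (Y : SubtorusFrame (prinPeriod Z) 2) :
    Y.realSpan = (Y.realSpan.comap ((prinPeriod Z : (Fin g ⊕ Fin g → ℝ) ≃L[ℝ] (Fin g → ℂ)) :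
      (Fin g ⊕ Fin g → ℝ) →ₗ[ℝ] (Fin g → ℂ))).map
        ((prinPeriod Z : (Fin g ⊕ Fin g → ℝ) ≃L[ℝ] (Fin g → ℂ)) : (Fin g ⊕ Fin g → ℝ) →ₗ[ℝ] (Fin g → ℂ)) :=
  (Submodule.map_comap_eq_of_surjective (prinPeriod Z).surjective _).symm

/-- The lattice plane of an elliptic curve has rank `2`: `dim_ℝ Φ_Z⁻¹(T_Y) = 2` (any genus).
[cite: Lange2023AbelianVarietiesComplex, §1.1.6 Exercise (2)(a) (p. 26)] -/
theorem finrank_comap_realSpan_prinPeriod_eq_two (Y : SubtorusFrame (prinPeriod Z) 2) :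
    finrank ℝ (Y.realSpan.comap ((prinPeriod Z : (Fin g ⊕ Fin g → ℝ) ≃L[ℝ] (Fin g → ℂ)) :
      (Fin g ⊕ Fin g → ℝ) →ₗ[ℝ] (Fin g → ℂ))) = 2 := by
  rw [finrank_eq_subRank Y.isLatticeSubspace]
  exact (Y.eq_subRank_of_realSpan_eq_map (prinPeriod Z) _ Y.isLatticeSubspace
    (realSpan_eq_map_comap_prinPeriod Z Y)).symm

/-- An elliptic curve needs room: if `X_Z` (`Z ∈ 𝔥_g`) contains an elliptic curve then `g ≥ 1`.
[cite: Lange2023AbelianVarietiesComplex, §1.1.6 Exercise (2)(a) (p. 26)] -/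
theorem one_le_of_subtorusFrame_two (Y : SubtorusFrame (prinPeriod Z) 2) : 1 ≤ g := by
  have h := (finrank_comap_realSpan_prinPeriod_eq_two Z Y).symm.trans_le (Submodule.finrank_le _)
  rw [Module.finrank_fintype_fun_eq_card, Fintype.card_sum, Fintype.card_fin] at h
  omega

/-- **The degree of an elliptic curve on `X_Z` is a positive integer**: `deg Y = −E_Z(Φλ′₀, Φλ′₁) ∈ ℤ_{>0}`
(`E_Z` is integral on the lattice and NEGATIVE on the oriented frame of a complex line, `H > 0`).
[cite: Auffarth2015EllipticCurvesAbelianVarieties, §2 (`deg C := (C · Θ)`) and Thm. 2.10 (`deg α > 0`)] -/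
theorem exists_nat_degree_eq (Y : SubtorusFrame (prinPeriod Z) 2) :
    ∃ d : ℕ, 0 < d ∧
      (d : ℝ) = -prinForm Z ![latticeVec (prinPeriod Z) (Y.frame 0), latticeVec (prinPeriod Z) (Y.frame 1)] := by
  have hη := isRiemannForm_prinForm Z
  obtain ⟨k, hk⟩ := hη.2.1 (Y.frame 0) (Y.frame 1)
  have hneg := hη.apply_frame_neg _ Y
  have hk' : prinForm Z ![latticeVec (prinPeriod Z) (Y.frame 0), latticeVec (prinPeriod Z) (Y.frame 1)] = k := hk
  rw [hk'] at hneg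
  have hk0 : k < 0 := by exact_mod_cast hneg
  refine ⟨(-k).toNat, by omega, ?_⟩
  rw [hk', show ((-k).toNat : ℝ) = ((-k : ℤ) : ℝ) by exact_mod_cast Int.toNat_of_nonneg (by omega), Int.cast_neg]

/-- **`|K(E_Z|_Y)| = (deg Y)²` for an elliptic curve `Y ⊂ X_Z` in every genus** (Riemann–Roch on `Y` / Bertrand's
Theorem 3: `(deg_λ(B)/b!)² = |K(λ|_B)|` with `b = 1`; p09's
`IsRiemannForm.torusIntegral_wedgePow_neg_wedge_cycleForm_div_factorial_sq`).
[cite: Lange2023AbelianVarietiesComplex, §5.3.1 Lemma 5.3.1 and §3.6 (Riemann–Roch)] [cite: Bertrand1997DualityTori, §3 Thm. 3 (i) (p. 212)] -/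
theorem natCard_subK_eq_degree_sq_prinPeriod (Y : SubtorusFrame (prinPeriod Z) 2) :
    ((Nat.card (subK (prinPeriod Z) (prinForm Z)
        (Y.realSpan.comap ((prinPeriod Z : (Fin g ⊕ Fin g → ℝ) ≃L[ℝ] (Fin g → ℂ)) :
          (Fin g ⊕ Fin g → ℝ) →ₗ[ℝ] (Fin g → ℂ)))) : ℕ) : ℝ) =
      (prinForm Z ![latticeVec (prinPeriod Z) (Y.frame 0), latticeVec (prinPeriod Z) (Y.frame 1)]) ^ 2 := by
  have hg := one_le_of_subtorusFrame_two Z Y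
  let e : Fin (2 * 1 + (2 * g - 2)) ≃ Fin g ⊕ Fin g := (finCongr (by omega)).trans finSumFinEquiv.symm
  have h := (isRiemannForm_prinForm Z).torusIntegral_wedgePow_neg_wedge_cycleForm_div_factorial_sq (r := 1)
    (prinPeriod Z) Y.isLatticeSubspace Y.isComplexSubspace Y (realSpan_eq_map_comap_prinPeriod Z Y) e
  rw [Nat.factorial_one, Nat.cast_one, div_one, wedgePow_one_eq_self,
    Y.torusIntegral_ofRealForm_wedge_cycleForm (prinPeriod Z) e (-prinForm Z),
    ContinuousAlternatingMap.neg_apply] at h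
  have h' : (((prinForm Z ![latticeVec (prinPeriod Z) (Y.frame 0), latticeVec (prinPeriod Z) (Y.frame 1)]) ^ 2 : ℝ) : ℂ) =
      ((Nat.card (subK (prinPeriod Z) (prinForm Z)
        (Y.realSpan.comap ((prinPeriod Z : (Fin g ⊕ Fin g → ℝ) ≃L[ℝ] (Fin g → ℂ)) :
          (Fin g ⊕ Fin g → ℝ) →ₗ[ℝ] (Fin g → ℂ)))) : ℕ) : ℂ) := by
    rw [← h]; push_cast; ring
  exact_mod_cast h'.symm

/-! ## §2 The bridge: abelian subvarieties of type `(d)` are the elliptic curves of degree `d` -/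

/-- **An elliptic curve of degree `d` is an abelian subvariety with induced polarization of type `(d)`** (every
genus): the type `(d′)` of `E_Z|_Y` on `Λ ∩ Φ_Z⁻¹(T_Y)` has `d′² = |K(E_Z|_Y)| = (deg Y)² = d²`.
[cite: IribarLopez2024NoetherLefschetzCycles, §1.5 (p. 4: `NL_{g,d}` and Greer–Lian's `(f^*θ) = d`)]
[cite: Lange2023AbelianVarietiesComplex, §1.5.1 (p. 51) and §5.3.1 Lemma 5.3.1] -/
theorem isSubPolarizationType_singleton_of_degree_eq (Y : SubtorusFrame (prinPeriod Z) 2) {d : ℕ}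
    (hdeg : (d : ℝ) = -prinForm Z ![latticeVec (prinPeriod Z) (Y.frame 0), latticeVec (prinPeriod Z) (Y.frame 1)]) :
    IsSubPolarizationType (prinPeriod Z : (Fin g ⊕ Fin g → ℝ) ≃L[ℝ] (Fin g → ℂ)) (prinForm Z)
      (Y.realSpan.comap ((prinPeriod Z : (Fin g ⊕ Fin g → ℝ) ≃L[ℝ] (Fin g → ℂ)) :
        (Fin g ⊕ Fin g → ℝ) →ₗ[ℝ] (Fin g → ℂ))) ![d] := by
  set W := Y.realSpan.comap ((prinPeriod Z : (Fin g ⊕ Fin g → ℝ) ≃L[ℝ] (Fin g → ℂ)) :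
    (Fin g ⊕ Fin g → ℝ) →ₗ[ℝ] (Fin g → ℂ)) with hWdef
  have hη := isRiemannForm_prinForm Z
  have hW : IsLatticeSubspace W := Y.isLatticeSubspace
  have hWc : IsComplexSubspace (prinPeriod Z : (Fin g ⊕ Fin g → ℝ) ≃L[ℝ] (Fin g → ℂ)) W := Y.isComplexSubspace
  obtain ⟨r, d', hd', -⟩ := hη.exists_isSubPolarizationType _ hW hWc
  have hr : r = 1 := by
    have h2 := hd'.two_mul_eq_finrank _ hW
    rw [hWdef, finrank_comap_realSpan_prinPeriod_eq_two Z Y] at h2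
    omega
  subst hr
  have hK : Nat.card (subK (prinPeriod Z : (Fin g ⊕ Fin g → ℝ) ≃L[ℝ] (Fin g → ℂ)) (prinForm Z) W) = d' 0 ^ 2 := by
    rw [hd'.natCard_subK _ hη hW hWc, Fin.prod_univ_one]
  have hKdeg := natCard_subK_eq_degree_sq_prinPeriod Z Y
  rw [← hWdef, hK, Nat.cast_pow] at hKdeg
  have hsq : (prinForm Z ![latticeVec (prinPeriod Z) (Y.frame 0), latticeVec (prinPeriod Z) (Y.frame 1)]) ^ 2 =
      (d : ℝ) ^ 2 := by
    rw [← neg_sq, ← hdeg]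
  have hd0 : d' 0 = d := by
    have h : ((d' 0 : ℝ)) ^ 2 = (d : ℝ) ^ 2 := hKdeg.trans hsq
    exact_mod_cast (pow_left_inj₀ (Nat.cast_nonneg _) (Nat.cast_nonneg _) two_ne_zero).1 h
  have hd'eq : d' = ![d] := by
    funext i
    fin_cases i
    simpa using hd0
  rw [← hd'eq]
  exact hd'

/-- **An abelian subvariety `Y = π(Φ_Z V) ⊂ X_Z` with induced polarization of type `(d)` is an elliptic curve of
degree `d`** (every genus; the frame is p36's `SubtorusFrame.ofSubspace`, with `Φ_Z⁻¹(T_Y) = V`).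
[cite: IribarLopez2024NoetherLefschetzCycles, §1.5 (p. 4)] [cite: Lange2023AbelianVarietiesComplex, §1.5.1 (p. 51) and §5.3.1 Lemma 5.3.1] -/
theorem exists_subtorusFrame_of_isSubPolarizationType_singleton {V : Submodule ℝ (Fin g ⊕ Fin g → ℝ)}
    (hV : IsLatticeSubspace V) (hVc : IsComplexSubspace (prinPeriod Z : (Fin g ⊕ Fin g → ℝ) ≃L[ℝ] (Fin g → ℂ)) V)
    {d : ℕ} (hd : IsSubPolarizationType (prinPeriod Z : (Fin g ⊕ Fin g → ℝ) ≃L[ℝ] (Fin g → ℂ)) (prinForm Z) V ![d]) :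
    ∃ Y : SubtorusFrame (prinPeriod Z) 2,
      Y.realSpan.comap ((prinPeriod Z : (Fin g ⊕ Fin g → ℝ) ≃L[ℝ] (Fin g → ℂ)) :
        (Fin g ⊕ Fin g → ℝ) →ₗ[ℝ] (Fin g → ℂ)) = V ∧
      (d : ℝ) = -prinForm Z ![latticeVec (prinPeriod Z) (Y.frame 0), latticeVec (prinPeriod Z) (Y.frame 1)] := by
  set Φ := (prinPeriod Z : (Fin g ⊕ Fin g → ℝ) ≃L[ℝ] (Fin g → ℂ)) with hΦ
  have hη := isRiemannForm_prinForm Z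
  have hsub : subRank V = 2 := by
    rw [← finrank_eq_subRank hV, finrank_eq_of_isSubPolarizationType hV hd]
  obtain ⟨k, eY, hpos⟩ := exists_orientationSign_subtorusPeriod_eq_one_two_mul Φ V hV hVc
  have hk : k = 1 := by
    have h := Fintype.card_congr eY
    simp only [Fintype.card_fin] at h
    omega
  subst hk
  set Y : SubtorusFrame Φ 2 := SubtorusFrame.ofSubspace Φ V hV hVc eY hpos with hYdef
  have hW : Y.realSpan.comap (Φ : (Fin g ⊕ Fin g → ℝ) →ₗ[ℝ] (Fin g → ℂ)) = V := by
    rw [hYdef, SubtorusFrame.realSpan_ofSubspace]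
    exact Submodule.comap_map_eq_of_injective Φ.injective V
  refine ⟨Y, hW, ?_⟩
  have hK : Nat.card (subK Φ (prinForm Z) V) = d ^ 2 := by
    rw [hd.natCard_subK _ hη hV hVc, Fin.prod_univ_one, Matrix.cons_val_fin_one]
  have hKdeg := natCard_subK_eq_degree_sq_prinPeriod Z Y
  rw [hW, hK, Nat.cast_pow] at hKdeg
  obtain ⟨δ, hδ, hδeq⟩ := exists_nat_degree_eq Z Y
  have hsq : ((d : ℝ)) ^ 2 = (δ : ℝ) ^ 2 := by rw [hKdeg, hδeq, neg_sq]
  have hdδ : (d : ℝ) = (δ : ℝ) :=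
    (pow_left_inj₀ (Nat.cast_nonneg _) (Nat.cast_nonneg _) two_ne_zero).1 hsq
  rw [hdδ]
  exact hδeq

/-- **IRIBAR LÓPEZ'S `NL_{g,d}` IS THE LOCUS OF P.P.A.V. CONTAINING AN ELLIPTIC CURVE OF DEGREE `d`** (every
genus; Kani's / Greer–Lian's reading «`f : E → (A, θ)` … `(f^*θ) = d`»): `Z ∈ NL_{g,(d)}` iff `X_Z` contains an
elliptic curve `Y` with `deg Y = −E_Z(Φλ′₀, Φλ′₁) = d`. [cite: IribarLopez2024NoetherLefschetzCycles, §1.5 (p. 4)]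
[cite: Auffarth2015EllipticCurvesAbelianVarieties, §2 (degree of a curve)] [cite: Kani1994EllipticCurvesAbelianSurfaces] -/
theorem mem_nlLocusType_singleton_iff_exists_ellipticCurve {d : ℕ} :
    Z ∈ nlLocusType g ![d] ↔
      ∃ Y : SubtorusFrame (prinPeriod Z) 2,
        (d : ℝ) = -prinForm Z ![latticeVec (prinPeriod Z) (Y.frame 0), latticeVec (prinPeriod Z) (Y.frame 1)] := by
  rw [mem_nlLocusType_iff]
  constructor
  · rintro ⟨V, hV, hVc, hdV⟩
    obtain ⟨Y, -, hY⟩ := exists_subtorusFrame_of_isSubPolarizationType_singleton Z hV hVc hdV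
    exact ⟨Y, hY⟩
  · rintro ⟨Y, hY⟩
    exact ⟨_, Y.isLatticeSubspace, Y.isComplexSubspace, isSubPolarizationType_singleton_of_degree_eq Z Y hY⟩

/-- `NL_{g,d}` as a set: `{Z ∈ 𝔥_g : X_Z ⊃ an elliptic curve of degree d}`. [cite: IribarLopez2024NoetherLefschetzCycles, §1.5 (p. 4)] -/
theorem nlLocusType_singleton_eq_setOf_exists_ellipticCurve (d : ℕ) :
    nlLocusType g ![d] =
      {Z : siegelUpperHalfSpace g | ∃ Y : SubtorusFrame (prinPeriod Z) 2,
        (d : ℝ) = -prinForm Z ![latticeVec (prinPeriod Z) (Y.frame 0), latticeVec (prinPeriod Z) (Y.frame 1)]} :=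
  Set.ext fun Z ↦ mem_nlLocusType_singleton_iff_exists_ellipticCurve Z

/-! ## §3 Corollaries: every degree occurs (`g ≥ 2`); type (i) of dimension `1` = `⋃_{d ≥ 1} NL_{g,d}` -/

/-- **For `g ≥ 2` and every `d ≥ 1` some principally polarised abelian variety of dimension `g` contains an
elliptic curve of degree `d`** (FILE 2's `nlLocusType_singleton_nonempty` read through §2).
[cite: IribarLopez2024NoetherLefschetzCycles, §1.5 (p. 4) and §2.2 (p. 7)] [cite: CanningOpreaPandharipande2024, §1.9 Thm. 13 (i) (p. 7)] -/
theorem exists_ellipticCurve_degree_eq (hg : 2 ≤ g) {d : ℕ} (hd : 0 < d) :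
    ∃ (Z : siegelUpperHalfSpace g) (Y : SubtorusFrame (prinPeriod Z) 2),
      (d : ℝ) = -prinForm Z ![latticeVec (prinPeriod Z) (Y.frame 0), latticeVec (prinPeriod Z) (Y.frame 1)] := by
  obtain ⟨Z, hZ⟩ := nlLocusType_singleton_nonempty hg hd
  obtain ⟨Y, hY⟩ := (mem_nlLocusType_singleton_iff_exists_ellipticCurve Z).1 hZ
  exact ⟨Z, Y, hY⟩

/-- **`NL_{g,0} = ∅`**: no elliptic curve has degree `0` (`deg > 0`). [cite: Auffarth2015EllipticCurvesAbelianVarieties, §2 Thm. 2.10 (`deg α > 0`)] -/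
theorem nlLocusType_singleton_zero : nlLocusType g ![0] = ∅ :=
  nlLocusType_eq_empty_of_eq_zero 0 rfl

/-- **Type (i) of dimension `1` is «contains an elliptic curve»**: `Z ∈ abelianSubvarietyLocus g 1` iff `X_Z` has a
subtorus frame of rank `2`. [cite: CanningOpreaPandharipande2024, §1.9 Thm. 13 (i) (p. 7)]
[cite: Lange2023AbelianVarietiesComplex, §1.1.6 Exercise (2)(a) (p. 26)] -/
theorem mem_abelianSubvarietyLocus_one_iff_nonempty_subtorusFrame :
    Z ∈ abelianSubvarietyLocus g 1 ↔ Nonempty (SubtorusFrame (prinPeriod Z) 2) := by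
  constructor
  · intro hZ
    rw [abelianSubvarietyLocus_eq_iUnion_nlLocusType, Set.mem_iUnion] at hZ
    obtain ⟨δ, hZ⟩ := hZ
    have hδ : δ = ![δ 0] := by
      funext i
      fin_cases i
      rfl
    rw [hδ] at hZ
    obtain ⟨Y, -⟩ := (mem_nlLocusType_singleton_iff_exists_ellipticCurve Z).1 hZ
    exact ⟨Y⟩
  · rintro ⟨Y⟩
    obtain ⟨d, -, hd⟩ := exists_nat_degree_eq Z Y
    exact nlLocusType_subset_abelianSubvarietyLocus ![d] ((mem_nlLocusType_singleton_iff_exists_ellipticCurve Z).2 ⟨Y, hd⟩)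

/-- **Type (i) of dimension `1` `= ⋃_{d ≥ 1} NL_{g,d}`**: `X_Z` contains an elliptic curve iff it contains one of
some degree `d ≥ 1` — the set-theoretic shadow of «[Greer–Lian's] `𝒩̃_{g,d}` … have several connected components
that correspond to our `NL_{g,e}`». [cite: IribarLopez2024NoetherLefschetzCycles, §1.5 (p. 4)]
[cite: CanningOpreaPandharipande2024, §1.9 Thm. 13 (i) (p. 7)] -/
theorem abelianSubvarietyLocus_one_eq_iUnion_nlLocusType_singleton :
    abelianSubvarietyLocus g 1 = ⋃ (d : ℕ) (_ : 0 < d), nlLocusType g ![d] := by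
  ext Z
  rw [mem_abelianSubvarietyLocus_one_iff_nonempty_subtorusFrame, Set.mem_iUnion₂]
  constructor
  · rintro ⟨Y⟩
    obtain ⟨d, hd, hdeg⟩ := exists_nat_degree_eq Z Y
    exact ⟨d, hd, (mem_nlLocusType_singleton_iff_exists_ellipticCurve Z).2 ⟨Y, hdeg⟩⟩
  · rintro ⟨d, -, hZ⟩
    obtain ⟨Y, -⟩ := (mem_nlLocusType_singleton_iff_exists_ellipticCurve Z).1 hZ
    exact ⟨Y⟩

/-- The non-simple locus contains every `NL_{g,d}` (`g ≥ 2`, `d` arbitrary): an elliptic curve on `X_Z` makes it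
non-simple. [cite: CanningOpreaPandharipande2024, §1.9 Thm. 13 (i) (p. 7)] -/
theorem nlLocusType_singleton_subset_nonSimpleLocus (hg : 2 ≤ g) (d : ℕ) : nlLocusType g ![d] ⊆ nonSimpleLocus g :=
  (nlLocusType_subset_abelianSubvarietyLocus _).trans (abelianSubvarietyLocus_subset_nonSimpleLocus one_pos (by omega))

end SiegelModuli

end Literature.AlgebraicGeometry.ModuliOfAbelianVarieties

end
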